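import Summits.FinalStateConjecture.FinalStateConjecture.Theses.StorageCertificates
import HarnessLib

/-!
# Birth skeleton — crux stmt-FinalStateConjecture-10925 `Theses.StorageCertificates.CertificateFamily` (rank 2)
# line `birth` (skeleton registrar planner-skel-stmt-FinalStateConjecture-10925-0, 2026-08-17; BC3 of run/shared/lean/lens3/_common/BC.md)

The crux (card K1 made uniform): for `0 < M`, `0 ≤ a₀ < M`, a frequency box `(ω_h, Λ_h)`, a threshold distance
`ε > 0` and a core `[r₊(1+δ), R_c]` there is ONE margin `η > 0` such that at every spin `0 ≤ a ≤ a₀`, every tortoise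
radius function `R` and every admissible strictly-superradiant `(ω, m, Λ)` in the box, the Carter radial operator
`u ↦ u'' + (ω² − V(R x))u` admits a normalised `C¹` storage form whose derivative form `H` is `⪰ 0` on `ℝ`, `⪰ η𝟙`
on the core, with signed end forms.

The cut is the route header's own TWO-LAYER PLAN for this node ("CertificateFamily ⇐ PointwiseCertificates (Theorem C
on the line with integrable tails + real-mode exclusion …) → MarginSemicontinuity (η lower semicontinuous in
(a, ω, m, Λ) ⇒ uniform on compacta) → CertificateFamily"), with each half split once more along the seam between what
is in print and what is new:

* `stub_realModeStability` (RMS; known in print AND proved in the tree — Teixeira da Costa 2020 Thm 4.1 at every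
  real `λ`, `Kerr.Costa2019_realAxisModeStability_holds` (`Literature/…/TeukolskyRealAxisModeStabilityFinal.lean`);
  Shlapentokh-Rothman 2015): no real mode of the Carter ODE, stated in Jost (limit) form on the tortoise line.
* `stub_lineCompleteness` (LC; the new mathematics, hardest): no real mode ⇒ pointwise normalised certificate with a
  core margin, on the LINE (tails without slack), uniformly over tortoise functions.
* `stub_marginRobust` (MR): the margin is locally uniform in `(a, ω, Λ)` inside the box.
* `stub_compactExtraction` (CE): the admissible box is compact (finitely many `m`, `ω₊(M,·)` continuous), so local
  uniformity gives one margin.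

RMS + LC give pointwise certificate families, MR makes them locally uniform, CE extracts one `η`, and the composition
weakens each certificate's margin `η' ≥ η` to `η` (the only place `η` enters is the core clause; `2 × 2` monotonicity).
Every stub except RMS is implied by the crux itself (LC, MR: specialise the box to a point / use the uniform `η`;
CE is a theorem of topology), and RMS is a published theorem: the cut adds no falsity risk, and no stub is the crux or
the summit in costume (BC3 probes, `Lines/birth.md`). All four signatures are DEF-FREE (fully qualified names, the
crux's clauses verbatim); the `Sig.*` legend below repeats them as named `Prop`s only so that `CertificateFamily_of`
has admissible binders. Disproof.lean: none exists for this crux at registration (`ledger crux ls`: no workfiles; no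
`_false_without_` obligations). Negatives index (1 entry, `not_UniformPhotonSphereChannels`, an `ℓ`-UNIFORM channel
inequality for the time-dependent Regge–Wheeler flow): unrelated — here `Λ ≤ Λ_h` is bounded and nothing is claimed
uniformly in `ℓ`.
-/

set_option linter.dupNamespace false

namespace Summit.FinalStateConjecture.FinalStateConjecture.Cruxes.CertificateFamily.Birth

/-! ## Legend: the four stub statements as named propositions (verbatim the registered signatures) -/

/-- Statement of `stub_realModeStability` (RMS): no real mode of the Carter radial ODE in the strictly superradiant admissible range, for every tortoise radius function. -/
def Sig.stub_realModeStability : Prop :=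
  ∀ (M a : ℝ), 0 < M → 0 ≤ a → a < M → ∀ (R : ℝ → ℝ), (∀ x, HasDerivAt R (((R x) ^ 2 - 2 * M * R x + a ^ 2) / ((R x) ^ 2 + a ^ 2)) x) → (∀ x, Literature.Geometry.Lorentzian.Kerr.rPlus M a < R x) → Filter.Tendsto R Filter.atBot (nhds (Literature.Geometry.Lorentzian.Kerr.rPlus M a)) → Filter.Tendsto R Filter.atTop Filter.atTop → ∀ (ω Λ : ℝ) (m : ℤ), |(m : ℝ)| * (|(m : ℝ)| + 1) ≤ Λ → 2 * |a * m * ω| ≤ Λ → 0 < ω → ω < m * Literature.Geometry.Lorentzian.Kerr.horizonAngularVelocity M a → ∀ (u u₁ : ℝ → ℂ), (∀ x, HasDerivAt u (u₁ x) x) → (∀ (x r P : ℝ), r = R x → P = ω ^ 2 - ((4 * M * r * a * m * ω - a ^ 2 * (m : ℝ) ^ 2 + (r ^ 2 - 2 * M * r + a ^ 2) * Λ) / (r ^ 2 + a ^ 2) ^ 2 + (r ^ 2 - 2 * M * r + a ^ 2) * (3 * r ^ 2 - 4 * M * r + a ^ 2) / (r ^ 2 + a ^ 2) ^ 3 - 3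 * (r ^ 2 - 2 * M * r + a ^ 2) ^ 2 * r ^ 2 / (r ^ 2 + a ^ 2) ^ 4) → HasDerivAt u₁ (-((P : ℝ) : ℂ) * u x) x) → Filter.Tendsto (fun x ↦ u₁ x - Complex.I * ((ω : ℝ) : ℂ) * u x) Filter.atTop (nhds 0) → Filter.Tendsto (fun x ↦ u₁ x + Complex.I * ((ω - m * Literature.Geometry.Lorentzian.Kerr.horizonAngularVelocity M a : ℝ) : ℂ) * u x) Filter.atBot (nhds 0) → ∀ x, u x = 0

/-- Statement of `stub_lineCompleteness` (LC): at one admissible superradiant frequency, no real mode ⇒ a normalised certificate with a positive core margin, uniformly over tortoise functions. -/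
def Sig.stub_lineCompleteness : Prop :=
  ∀ (M a : ℝ), 0 < M → 0 ≤ a → a < M → ∀ (δ Rc : ℝ), 0 < δ → ∀ (ω Λ : ℝ) (m : ℤ), |(m : ℝ)| * (|(m : ℝ)| + 1) ≤ Λ → 2 * |a * m * ω| ≤ Λ → 0 < ω → ω < m * Literature.Geometry.Lorentzian.Kerr.horizonAngularVelocity M a → (∀ (R : ℝ → ℝ), (∀ x, HasDerivAt R (((R x) ^ 2 - 2 * M * R x + a ^ 2) / ((R x) ^ 2 + a ^ 2)) x) → (∀ x, Literature.Geometry.Lorentzian.Kerr.rPlus M a < R x) → Filter.Tendsto R Filter.atBot (nhds (Literature.Geometry.Lorentzian.Kerr.rPlus M a)) → Filter.Tendsto R Filter.atTop Filter.atTop → ∀ (u u₁ : ℝ → ℂ), (∀ x, HasDerivAt u (u₁ x) x) → (∀ (x r P : ℝ), r = R x → P = ω ^ 2 - ((4 * M * r * a * m * ω - a ^ 2 * (m : ℝ) ^ 2 + (r ^ 2 - 2 * M * r + a ^ 2) * Λ) / (r ^ 2 + a ^ 2) ^ 2 + (r ^ 2 - 2 * M * r + a ^ 2) * (3 * r ^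 2 - 4 * M * r + a ^ 2) / (r ^ 2 + a ^ 2) ^ 3 - 3 * (r ^ 2 - 2 * M * r + a ^ 2) ^ 2 * r ^ 2 / (r ^ 2 + a ^ 2) ^ 4) → HasDerivAt u₁ (-((P : ℝ) : ℂ) * u x) x) → Filter.Tendsto (fun x ↦ u₁ x - Complex.I * ((ω : ℝ) : ℂ) * u x) Filter.atTop (nhds 0) → Filter.Tendsto (fun x ↦ u₁ x + Complex.I * ((ω - m * Literature.Geometry.Lorentzian.Kerr.horizonAngularVelocity M a : ℝ) : ℂ) * u x) Filter.atBot (nhds 0) → ∀ x, u x = 0) → ∃ η : ℝ, 0 < η ∧ ∀ (R : ℝ → ℝ), (∀ x, HasDerivAt R (((R x) ^ 2 - 2 * M * R x + a ^ 2) / ((R x) ^ 2 + a ^ 2)) x) → (∀ x, Literature.Geometry.Lorentzian.Kerr.rPlus M a < R x) → Filter.Tendsto R Filter.atBot (nhds (Literature.Geometry.Lorentzian.Kerr.rPlus M a)) → Filter.Tendsto R Filter.atTop Filter.atTop → ∃ (α γ α₁ γ₁ : ℝ → ℝ) (β β₁ : ℝ → ℂ) (αp bp γp αm bm γm : ℝ),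 (∀ x, HasDerivAt α (α₁ x) x ∧ HasDerivAt γ (γ₁ x) x ∧ HasDerivAt β (β₁ x) x) ∧ Continuous α₁ ∧ Continuous γ₁ ∧ Continuous β₁ ∧ (∀ x, |α x| ≤ 1 ∧ |γ x| ≤ 1 ∧ ‖β x‖ ≤ 1) ∧ Filter.Tendsto α Filter.atTop (nhds αp) ∧ Filter.Tendsto (fun x ↦ (β x).im) Filter.atTop (nhds bp) ∧ Filter.Tendsto γ Filter.atTop (nhds γp) ∧ Filter.Tendsto (fun x ↦ (β x).re) Filter.atTop (nhds 0) ∧ Filter.Tendsto α Filter.atBot (nhds αm) ∧ Filter.Tendsto (fun x ↦ (β x).im) Filter.atBot (nhds bm) ∧ Filter.Tendsto γ Filter.atBot (nhds γm) ∧ Filter.Tendsto (fun x ↦ (β x).re) Filter.atBot (nhds 0) ∧ γp + ω ^ 2 * αp + 2 * ω * bp ≤ 0 ∧ 0 ≤ γm + (ω - m * Literature.Geometry.Lorentzian.Kerr.horizonAngularVelocity M a) ^ 2 * αm - 2 * (ω - m * Literature.Geometry.Lorentzian.Kerr.horizonAngularVelocity M a) * bm ∧ ∀ (x r P h11 h22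 : ℝ) (h12 : ℂ), r = R x → P = ω ^ 2 - ((4 * M * r * a * m * ω - a ^ 2 * (m : ℝ) ^ 2 + (r ^ 2 - 2 * M * r + a ^ 2) * Λ) / (r ^ 2 + a ^ 2) ^ 2 + (r ^ 2 - 2 * M * r + a ^ 2) * (3 * r ^ 2 - 4 * M * r + a ^ 2) / (r ^ 2 + a ^ 2) ^ 3 - 3 * (r ^ 2 - 2 * M * r + a ^ 2) ^ 2 * r ^ 2 / (r ^ 2 + a ^ 2) ^ 4) → h11 = α₁ x + 2 * (β x).re → h22 = γ₁ x - 2 * P * (β x).re → h12 = β₁ x + ((γ x - α x * P : ℝ) : ℂ) → (0 ≤ h11 ∧ 0 ≤ h22 ∧ ‖h12‖ ^ 2 ≤ h11 * h22) ∧ (Literature.Geometry.Lorentzian.Kerr.rPlus M a * (1 + δ) ≤ r → r ≤ Rc → η ≤ h11 ∧ η ≤ h22 ∧ ‖h12‖ ^ 2 ≤ (h11 - η) * (h22 - η))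

/-- Statement of `stub_marginRobust` (MR): certificate existence with positive margin is locally uniform in `(a, ω, Λ)` inside the box. -/
def Sig.stub_marginRobust : Prop :=
  ∀ (M a₀ : ℝ), 0 < M → 0 ≤ a₀ → a₀ < M → ∀ (ωh Λh ε δ Rc : ℝ), 0 < ε → 0 < δ → ∀ (a ω Λ : ℝ) (m : ℤ), 0 ≤ a → a ≤ a₀ → |(m : ℝ)| * (|(m : ℝ)| + 1) ≤ Λ → 2 * |a * m * ω| ≤ Λ → |ω| ≤ ωh → Λ ≤ Λh → ε ≤ ω → ω + ε ≤ m * Literature.Geometry.Lorentzian.Kerr.horizonAngularVelocity M a → (∃ η₀ : ℝ, 0 < η₀ ∧ ∀ (R : ℝ → ℝ), (∀ x, HasDerivAt R (((R x) ^ 2 - 2 * M * R x + a ^ 2) / ((R x) ^ 2 + a ^ 2)) x) → (∀ x, Literature.Geometry.Lorentzian.Kerr.rPlus M a < R x) → Filter.Tendsto R Filter.atBot (nhds (Literature.Geometry.Lorentzian.Kerr.rPlus M a)) → Filter.Tendsto R Filter.atTop Filter.atTop → ∃ (α γ α₁ γ₁ : ℝ → ℝ) (β β₁ : ℝ → ℂ)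 (αp bp γp αm bm γm : ℝ), (∀ x, HasDerivAt α (α₁ x) x ∧ HasDerivAt γ (γ₁ x) x ∧ HasDerivAt β (β₁ x) x) ∧ Continuous α₁ ∧ Continuous γ₁ ∧ Continuous β₁ ∧ (∀ x, |α x| ≤ 1 ∧ |γ x| ≤ 1 ∧ ‖β x‖ ≤ 1) ∧ Filter.Tendsto α Filter.atTop (nhds αp) ∧ Filter.Tendsto (fun x ↦ (β x).im) Filter.atTop (nhds bp) ∧ Filter.Tendsto γ Filter.atTop (nhds γp) ∧ Filter.Tendsto (fun x ↦ (β x).re) Filter.atTop (nhds 0) ∧ Filter.Tendsto α Filter.atBot (nhds αm) ∧ Filter.Tendsto (fun x ↦ (β x).im) Filter.atBot (nhds bm) ∧ Filter.Tendsto γ Filter.atBot (nhds γm) ∧ Filter.Tendsto (fun x ↦ (β x).re) Filter.atBot (nhds 0) ∧ γp + ω ^ 2 * αp + 2 * ω * bp ≤ 0 ∧ 0 ≤ γm + (ω - m * Literature.Geometry.Lorentzian.Kerr.horizonAngularVelocity M a) ^ 2 * αm - 2 * (ω - m * Literature.Geometry.Lorentzian.Kerr.horizonAngularVelocity M a) *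 bm ∧ ∀ (x r P h11 h22 : ℝ) (h12 : ℂ), r = R x → P = ω ^ 2 - ((4 * M * r * a * m * ω - a ^ 2 * (m : ℝ) ^ 2 + (r ^ 2 - 2 * M * r + a ^ 2) * Λ) / (r ^ 2 + a ^ 2) ^ 2 + (r ^ 2 - 2 * M * r + a ^ 2) * (3 * r ^ 2 - 4 * M * r + a ^ 2) / (r ^ 2 + a ^ 2) ^ 3 - 3 * (r ^ 2 - 2 * M * r + a ^ 2) ^ 2 * r ^ 2 / (r ^ 2 + a ^ 2) ^ 4) → h11 = α₁ x + 2 * (β x).re → h22 = γ₁ x - 2 * P * (β x).re → h12 = β₁ x + ((γ x - α x * P : ℝ) : ℂ) → (0 ≤ h11 ∧ 0 ≤ h22 ∧ ‖h12‖ ^ 2 ≤ h11 * h22) ∧ (Literature.Geometry.Lorentzian.Kerr.rPlus M a * (1 + δ) ≤ r → r ≤ Rc → η₀ ≤ h11 ∧ η₀ ≤ h22 ∧ ‖h12‖ ^ 2 ≤ (h11 - η₀) * (h22 - η₀))) → ∃ ρ : ℝ, 0 < ρ ∧ ∃ η : ℝ, 0 < η ∧ ∀ (a' ω' Λ' : ℝ),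 0 ≤ a' → a' ≤ a₀ → |(m : ℝ)| * (|(m : ℝ)| + 1) ≤ Λ' → 2 * |a' * m * ω'| ≤ Λ' → |ω'| ≤ ωh → Λ' ≤ Λh → ε ≤ ω' → ω' + ε ≤ m * Literature.Geometry.Lorentzian.Kerr.horizonAngularVelocity M a' → |a' - a| < ρ → |ω' - ω| < ρ → |Λ' - Λ| < ρ → ∀ (R : ℝ → ℝ), (∀ x, HasDerivAt R (((R x) ^ 2 - 2 * M * R x + a' ^ 2) / ((R x) ^ 2 + a' ^ 2)) x) → (∀ x, Literature.Geometry.Lorentzian.Kerr.rPlus M a' < R x) → Filter.Tendsto R Filter.atBot (nhds (Literature.Geometry.Lorentzian.Kerr.rPlus M a')) → Filter.Tendsto R Filter.atTop Filter.atTop → ∃ (α γ α₁ γ₁ : ℝ → ℝ) (β β₁ : ℝ → ℂ) (αp bp γp αm bm γm : ℝ), (∀ x, HasDerivAt α (α₁ x) x ∧ HasDerivAt γ (γ₁ x) x ∧ HasDerivAt β (β₁ x) x) ∧ Continuous α₁ ∧ Continuous γ₁ ∧ Continuous β₁ ∧ (∀ x, |α x| ≤ 1 ∧ |γ x| ≤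 1 ∧ ‖β x‖ ≤ 1) ∧ Filter.Tendsto α Filter.atTop (nhds αp) ∧ Filter.Tendsto (fun x ↦ (β x).im) Filter.atTop (nhds bp) ∧ Filter.Tendsto γ Filter.atTop (nhds γp) ∧ Filter.Tendsto (fun x ↦ (β x).re) Filter.atTop (nhds 0) ∧ Filter.Tendsto α Filter.atBot (nhds αm) ∧ Filter.Tendsto (fun x ↦ (β x).im) Filter.atBot (nhds bm) ∧ Filter.Tendsto γ Filter.atBot (nhds γm) ∧ Filter.Tendsto (fun x ↦ (β x).re) Filter.atBot (nhds 0) ∧ γp + ω' ^ 2 * αp + 2 * ω' * bp ≤ 0 ∧ 0 ≤ γm + (ω' - m * Literature.Geometry.Lorentzian.Kerr.horizonAngularVelocity M a') ^ 2 * αm - 2 * (ω' - m * Literature.Geometry.Lorentzian.Kerr.horizonAngularVelocity M a') * bm ∧ ∀ (x r P h11 h22 : ℝ) (h12 : ℂ), r = R x → P = ω' ^ 2 - ((4 * M * r * a' * m * ω' - a' ^ 2 * (m : ℝ) ^ 2 + (r ^ 2 - 2 * M * r + a' ^ 2) * Λ') / (r ^ 2 + a' ^ 2) ^ 2 + (r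 ^ 2 - 2 * M * r + a' ^ 2) * (3 * r ^ 2 - 4 * M * r + a' ^ 2) / (r ^ 2 + a' ^ 2) ^ 3 - 3 * (r ^ 2 - 2 * M * r + a' ^ 2) ^ 2 * r ^ 2 / (r ^ 2 + a' ^ 2) ^ 4) → h11 = α₁ x + 2 * (β x).re → h22 = γ₁ x - 2 * P * (β x).re → h12 = β₁ x + ((γ x - α x * P : ℝ) : ℂ) → (0 ≤ h11 ∧ 0 ≤ h22 ∧ ‖h12‖ ^ 2 ≤ h11 * h22) ∧ (Literature.Geometry.Lorentzian.Kerr.rPlus M a' * (1 + δ) ≤ r → r ≤ Rc → η ≤ h11 ∧ η ≤ h22 ∧ ‖h12‖ ^ 2 ≤ (h11 - η) * (h22 - η))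

/-- Statement of `stub_compactExtraction` (CE): locally uniform ⇒ uniform on the (compact) admissible box, for any predicate. -/
def Sig.stub_compactExtraction : Prop :=
  ∀ (M a₀ : ℝ), 0 < M → 0 ≤ a₀ → a₀ < M → ∀ (ωh Λh ε : ℝ), 0 < ε → ∀ (good : ℝ → ℝ → ℝ → ℤ → ℝ → Prop), (∀ (a ω Λ : ℝ) (m : ℤ), 0 ≤ a → a ≤ a₀ → |(m : ℝ)| * (|(m : ℝ)| + 1) ≤ Λ → 2 * |a * m * ω| ≤ Λ → |ω| ≤ ωh → Λ ≤ Λh → ε ≤ ω → ω + ε ≤ m * Literature.Geometry.Lorentzian.Kerr.horizonAngularVelocity M a → ∃ ρ : ℝ, 0 < ρ ∧ ∃ η : ℝ, 0 < η ∧ ∀ (a' ω' Λ' : ℝ), 0 ≤ a' → a' ≤ a₀ → |(m : ℝ)| * (|(m : ℝ)| + 1) ≤ Λ' → 2 * |a' * m * ω'| ≤ Λ' → |ω'| ≤ ωh → Λ' ≤ Λh → ε ≤ ω' → ω' + ε ≤ m * Literature.Geometry.Lorentzian.Kerr.horizonAngularVelocity M a' → |a' - a| < ρ → |ω' - ω|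 < ρ → |Λ' - Λ| < ρ → good a' ω' Λ' m η) → ∃ η : ℝ, 0 < η ∧ ∀ (a ω Λ : ℝ) (m : ℤ), 0 ≤ a → a ≤ a₀ → |(m : ℝ)| * (|(m : ℝ)| + 1) ≤ Λ → 2 * |a * m * ω| ≤ Λ → |ω| ≤ ωh → Λ ≤ Λh → ε ≤ ω → ω + ε ≤ m * Literature.Geometry.Lorentzian.Kerr.horizonAngularVelocity M a → ∃ η' : ℝ, η ≤ η' ∧ good a ω Λ m η'

/-! ## Registered stubs (`sorry` only here; signatures def-free and self-contained) -/

/-- **RMS — REAL-AXIS RADIAL MODE STABILITY, Carter–Schrödinger form, `s = 0`, strictly superradiant box**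
(known in print; size L to formalise, M to bridge from the vendored fact). For `0 < M`, `0 ≤ a < M`, any tortoise
radius function `R` (`dR/dx = Δ(R)/(R² + a²)`, `R > r₊`, `R → r₊` at `−∞`, `R → ∞` at `+∞`), any admissible
`(ω, m, Λ)` (`Λ ≥ |m|(|m|+1)`, `Λ ≥ 2|amω|`, `Λ` NOT required to be a separation constant) with `0 < ω < mω₊`:
every `C²` solution `u` of the radial ODE `u'' + (ω² − V(R x)) u = 0` on `ℝ` (`V` = the printed potential of
arXiv:1402.7034 §5.2.3, inlined exactly as in the crux) which is OUTGOING at `𝓘⁺` (`u' − iωu → 0` as `x → +∞`)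
and REGULAR AT `𝓗⁺` (`u' + i(ω − mω₊)u → 0` as `x → −∞`) vanishes identically. Since `P → ω² > 0` at `+∞` with
`P − ω² = O(x⁻²)` and `P → (ω − mω₊)² > 0` exponentially fast at `−∞` (sub-extremality), Jost solutions
`e^{±iωx}(1+o(1))`, `e^{±i(ω−mω₊)x}(1+o(1))` exist and the two limit conditions select exactly the outgoing /
horizon-regular branches (`ω ≠ 0`, `ω − mω₊ ≠ 0`), i.e. Teixeira da Costa's Def. 2.4 for `s = 0` under
`u = (r²+a²)^{1/2} R_{TdC}`, `(r − r₊)^{ξ} = e^{−i(ω−mω₊)x}`, `e^{iωr} r^{2iMω−1}·r = e^{iωx}`.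
Why plausibly true: it IS Teixeira da Costa, CMP 378 (2020) = arXiv:1910.02854, Thm 4.1 (real `ω ≠ 0`, ANY real
`λ` — p. 31: "Theorems 4.1 and 4.2 do not require `λ` to be a separation constant", `|a| < M`), earlier
Shlapentokh-Rothman arXiv:1302.6902 Thm 1.6 (`s = 0`); and the named fact
`Literature.Geometry.Lorentzian.Kerr.Costa2019_realAxisModeStability` is now PROVED in the tree
(`Kerr.Costa2019_realAxisModeStability_holds`, `TeukolskyRealAxisModeStabilityFinal.lean`; not imported here to keep
this file's cone equal to the route's). Expected closure (size M): the bridge from that theorem — (i) the inverse of the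
tree's Carter ↔ Teukolsky-radial dictionary `Kerr.schrodingerForm` (`u = (r²+a²)^{1/2} R_T ∘ ρ`, `λ_TdC = Λ − a²ω²`,
`V = Kerr.sepPotential M a ω m Λ` = the inlined potential by `Kerr.sepPotential_eq`), transporting `u` back to a
classical solution `R_T` on `(r₊, ∞)` through the inverse tortoise map; (ii) the two limit conditions ⇒ TdC's
Def. 2.4: at `+∞` via the Jost decomposition `Kerr.exists_jostDecomposition` (`R = A·R_𝓘 + B·R̄_𝓘`) and the
normalised limits `Kerr.tendsto_norm_infinitySolution` / `…_deriv_…` (`u' − iωu → 0` forces `B = 0`), at `r₊` via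
`Kerr.jost_normalisedHorizon` / `TeukolskyHorizonNormalisedLimits` (`u' + ik₋u → 0` forces the `(r − r₊)^{ξ}` branch).
Why it might fail: only through a mismatch of conventions (sign of the horizon phase `k₋ = ω − mω₊`, the `λ`
dictionary) — the analysis is settled in print and in the tree. Sources: arXiv:1910.02854 Thm 4.1 + p. 31;
arXiv:1302.6902 Thm 1.6; arXiv:1402.7034 §5.2.3. -/
theorem stub_realModeStability : ∀ (M a : ℝ), 0 < M → 0 ≤ a → a < M → ∀ (R : ℝ → ℝ), (∀ x, HasDerivAt R (((R x) ^ 2 - 2 * M * R x + a ^ 2) / ((R x) ^ 2 + a ^ 2)) x) → (∀ x, Literature.Geometry.Lorentzian.Kerr.rPlus M a < R x) → Filter.Tendsto R Filter.atBot (nhds (Literature.Geometry.Lorentzian.Kerr.rPlus M a)) → Filter.Tendsto R Filter.atTop Filter.atTop → ∀ (ω Λ : ℝ) (m : ℤ), |(m : ℝ)| * (|(m : ℝ)| + 1) ≤ Λ → 2 * |a * m * ω| ≤ Λ → 0 < ω → ω < m * Literature.Geometry.Lorentzian.Kerr.horizonAngularVelocity M a → ∀ (u u₁ : ℝ → ℂ),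 (∀ x, HasDerivAt u (u₁ x) x) → (∀ (x r P : ℝ), r = R x → P = ω ^ 2 - ((4 * M * r * a * m * ω - a ^ 2 * (m : ℝ) ^ 2 + (r ^ 2 - 2 * M * r + a ^ 2) * Λ) / (r ^ 2 + a ^ 2) ^ 2 + (r ^ 2 - 2 * M * r + a ^ 2) * (3 * r ^ 2 - 4 * M * r + a ^ 2) / (r ^ 2 + a ^ 2) ^ 3 - 3 * (r ^ 2 - 2 * M * r + a ^ 2) ^ 2 * r ^ 2 / (r ^ 2 + a ^ 2) ^ 4) → HasDerivAt u₁ (-((P : ℝ) : ℂ) * u x) x) → Filter.Tendsto (fun x ↦ u₁ x - Complex.I * ((ω : ℝ) : ℂ) * u x) Filter.atTop (nhds 0) → Filter.Tendsto (fun x ↦ u₁ x + Complex.I * ((ω - m * Literature.Geometry.Lorentzian.Kerr.horizonAngularVelocity M a : ℝ) : ℂ) * u x) Filter.atBot (nhds 0) → ∀ x, u x = 0 := by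
  sorry

/-- **LC — THEOREM C ON THE LINE (converse-Lyapunov / completeness half with non-compact tails)** (the
genuinely new piece; size L). Fix `0 < M`, `0 ≤ a < M`, `δ > 0`, `R_c`, and ONE admissible frequency `(ω, m, Λ)` with
`0 < ω < mω₊`. If the Carter radial operator has no real mode for any tortoise radius function (the conclusion schema
of RMS), then there is a margin `η > 0` such that for EVERY tortoise radius function `R` a normalised `C¹` storage
form `𝕄 = [[α, β],[β̄, γ]]` exists with exactly the crux's clauses: sup-norms `≤ 1`, limits at `±∞` with `Re β → 0`,
the two signed end forms (`γ₊ + ω²α₊ + 2ωb₊ ≤ 0`, `0 ≤ γ₋ + k₋²α₋ − 2k₋b₋`, `k₋ = ω − mω₊`), `H ⪰ 0` on `ℝ` and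
`H ⪰ η𝟙` on the core `r₊(1+δ) ≤ R(x) ≤ R_c` (one `η` for all `R`: tortoise functions are translates of one another
and certificates translate with them). Mechanism (route card, Theorem C): open-cone theorem of alternatives —
Hahn–Banach against the sup-norm interior of the pointwise-PSD cone; a dual PSD matrix measure `N` with
`N' = 𝒜N + N𝒜†` is forced to rank one on the boundary lines, `N = zz†` with `z` a real mode, excluded by hypothesis;
the compact-interval version is the route's support item `CertificateCompleteness` (stmt-9932). What is NEW here is
the passage to the line: the tails `x → ±∞` carry no slack (`H ⪰ 0` only), so the certificate must be matched to the
Jost asymptotics of `P` (`P − ω² = O(x⁻²)` at `+∞`, exponential at `−∞`).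
Why it might fail (route header, (ii)): slack-free `H ⪰ 0` on the non-compact tails, where compact open-cone duality
is silent — a duality gap between `C¹` certificates with limits and measure-valued duals escaping to infinity; the
normalisation `sup ≤ 1` must be compatible with `η > 0` on a long core `[r₊(1+δ), R_c]`.
Sources: doi:10.1007/BF00276493 (Willems), doi:10.1016/0167-6911(95)00063-1, doi:10.1109/TAC.2002.806652 (KYP),
arXiv:1705.07096, arXiv:1402.7034 §§8.2–8.7 (the hand-built currents are points of the cone). -/
theorem stub_lineCompleteness : ∀ (M a : ℝ), 0 < M → 0 ≤ a → a < M → ∀ (δ Rc : ℝ), 0 < δ → ∀ (ω Λ : ℝ) (m : ℤ), |(m : ℝ)| * (|(m : ℝ)| + 1) ≤ Λ → 2 * |a * m * ω| ≤ Λ → 0 < ω → ω < m * Literature.Geometry.Lorentzian.Kerr.horizonAngularVelocity M a → (∀ (R : ℝ → ℝ), (∀ x, HasDerivAt R (((R x) ^ 2 - 2 * M * R x + a ^ 2) / ((R x) ^ 2 + a ^ 2)) x) → (∀ x, Literature.Geometry.Lorentzian.Kerr.rPlus M a < R x) → Filter.Tendsto R Filter.atBot (nhds (Literature.Geometry.Lorentzian.Kerr.rPlus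 M a)) → Filter.Tendsto R Filter.atTop Filter.atTop → ∀ (u u₁ : ℝ → ℂ), (∀ x, HasDerivAt u (u₁ x) x) → (∀ (x r P : ℝ), r = R x → P = ω ^ 2 - ((4 * M * r * a * m * ω - a ^ 2 * (m : ℝ) ^ 2 + (r ^ 2 - 2 * M * r + a ^ 2) * Λ) / (r ^ 2 + a ^ 2) ^ 2 + (r ^ 2 - 2 * M * r + a ^ 2) * (3 * r ^ 2 - 4 * M * r + a ^ 2) / (r ^ 2 + a ^ 2) ^ 3 - 3 * (r ^ 2 - 2 * M * r + a ^ 2) ^ 2 * r ^ 2 / (r ^ 2 + a ^ 2) ^ 4) → HasDerivAt u₁ (-((P : ℝ) : ℂ) * u x) x) → Filter.Tendsto (fun x ↦ u₁ x - Complex.I * ((ω : ℝ) : ℂ) * u x) Filter.atTop (nhds 0) → Filter.Tendsto (fun x ↦ u₁ x + Complex.I * ((ω - m * Literature.Geometry.Lorentzian.Kerr.horizonAngularVelocity M a : ℝ) : ℂ) * u x) Filter.atBot (nhds 0) → ∀ x, u x = 0) → ∃ η : ℝ, 0 < η ∧ ∀ (R : ℝ → ℝ), (∀ x, HasDerivAt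 R (((R x) ^ 2 - 2 * M * R x + a ^ 2) / ((R x) ^ 2 + a ^ 2)) x) → (∀ x, Literature.Geometry.Lorentzian.Kerr.rPlus M a < R x) → Filter.Tendsto R Filter.atBot (nhds (Literature.Geometry.Lorentzian.Kerr.rPlus M a)) → Filter.Tendsto R Filter.atTop Filter.atTop → ∃ (α γ α₁ γ₁ : ℝ → ℝ) (β β₁ : ℝ → ℂ) (αp bp γp αm bm γm : ℝ), (∀ x, HasDerivAt α (α₁ x) x ∧ HasDerivAt γ (γ₁ x) x ∧ HasDerivAt β (β₁ x) x) ∧ Continuous α₁ ∧ Continuous γ₁ ∧ Continuous β₁ ∧ (∀ x, |α x| ≤ 1 ∧ |γ x| ≤ 1 ∧ ‖β x‖ ≤ 1) ∧ Filter.Tendsto α Filter.atTop (nhds αp) ∧ Filter.Tendsto (fun x ↦ (β x).im) Filter.atTop (nhds bp) ∧ Filter.Tendsto γ Filter.atTop (nhds γp) ∧ Filter.Tendsto (fun x ↦ (β x).re) Filter.atTop (nhds 0) ∧ Filter.Tendsto α Filter.atBot (nhds αm) ∧ Filter.Tendsto (fun x ↦ (β x).im) Filter.atBot (nhds bm) ∧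 Filter.Tendsto γ Filter.atBot (nhds γm) ∧ Filter.Tendsto (fun x ↦ (β x).re) Filter.atBot (nhds 0) ∧ γp + ω ^ 2 * αp + 2 * ω * bp ≤ 0 ∧ 0 ≤ γm + (ω - m * Literature.Geometry.Lorentzian.Kerr.horizonAngularVelocity M a) ^ 2 * αm - 2 * (ω - m * Literature.Geometry.Lorentzian.Kerr.horizonAngularVelocity M a) * bm ∧ ∀ (x r P h11 h22 : ℝ) (h12 : ℂ), r = R x → P = ω ^ 2 - ((4 * M * r * a * m * ω - a ^ 2 * (m : ℝ) ^ 2 + (r ^ 2 - 2 * M * r + a ^ 2) * Λ) / (r ^ 2 + a ^ 2) ^ 2 + (r ^ 2 - 2 * M * r + a ^ 2) * (3 * r ^ 2 - 4 * M * r + a ^ 2) / (r ^ 2 + a ^ 2) ^ 3 - 3 * (r ^ 2 - 2 * M * r + a ^ 2) ^ 2 * r ^ 2 / (r ^ 2 + a ^ 2) ^ 4) → h11 = α₁ x + 2 * (β x).re → h22 = γ₁ x - 2 * P * (β x).re → h12 = β₁ x + ((γ x - α x * P : ℝ) : ℂ) → (0 ≤ h11 ∧ 0 ≤ h22 ∧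 ‖h12‖ ^ 2 ≤ h11 * h22) ∧ (Literature.Geometry.Lorentzian.Kerr.rPlus M a * (1 + δ) ≤ r → r ≤ Rc → η ≤ h11 ∧ η ≤ h22 ∧ ‖h12‖ ^ 2 ≤ (h11 - η) * (h22 - η)) := by
  sorry

/-- **MR — LOCAL ROBUSTNESS OF THE MARGIN IN THE FREQUENCY–SPIN PARAMETERS** (size M/L). Inside the crux's box
`K = {0 ≤ a ≤ a₀, Λ ≥ |m|(|m|+1), Λ ≥ 2|amω|, |ω| ≤ ω_h, Λ ≤ Λ_h, ε ≤ ω ≤ mω₊(M,a) − ε}`: if at one parameter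
`(a, ω, Λ, m) ∈ K` a certificate family with margin `η₀ > 0` on the core exists for every tortoise `R` (the output of
LC), then there are `ρ > 0` and `η > 0` such that at every `(a', ω', Λ', m) ∈ K` (same `m`) with
`|a' − a|, |ω' − ω|, |Λ' − Λ| < ρ`, and every tortoise radius function of spin `a'`, a certificate with margin `η`
exists. Mechanism: `H_𝕄` depends on the parameters only through `P = ω² − V_{M,a,ω,m,Λ}(R x)`, affinely
(`−αP` in `h₁₂`, `−2P Re β` in `h₂₂`); on the core the margin absorbs `‖∂P‖·ρ`; on the tails one re-solves the
certificate along the perturbed Jost data (the end forms and the limits move continuously, `k₋ = ω − mω₊(M,a')`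
stays `≤ −ε < 0`, `ω' ≥ ε > 0`), or one runs LC's duality with a parameter and extracts lower semicontinuity of the
optimal margin. Implied by the crux itself (which gives one `η` on all of `K`), so no falsity is added.
Why it might fail (route header, (ii)–(iii)): the tails have NO slack — a pointwise certificate at `(a, ω, Λ)` need
not survive any perturbation of `P` at `±∞`, and the spin enters the tortoise ODE and `r₊(M,a')` (the core and the
horizon move with `a'`), so robustness is a statement about the existence problem, not about one certificate.
Sources: arXiv:1402.7034 §8 (continuity-in-`a` architecture), doi:10.1007/s00220-020-03796-z, doi:10.1007/BF00276493. -/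
theorem stub_marginRobust : ∀ (M a₀ : ℝ), 0 < M → 0 ≤ a₀ → a₀ < M → ∀ (ωh Λh ε δ Rc : ℝ), 0 < ε → 0 < δ → ∀ (a ω Λ : ℝ) (m : ℤ), 0 ≤ a → a ≤ a₀ → |(m : ℝ)| * (|(m : ℝ)| + 1) ≤ Λ → 2 * |a * m * ω| ≤ Λ → |ω| ≤ ωh → Λ ≤ Λh → ε ≤ ω → ω + ε ≤ m * Literature.Geometry.Lorentzian.Kerr.horizonAngularVelocity M a → (∃ η₀ : ℝ, 0 < η₀ ∧ ∀ (R : ℝ → ℝ), (∀ x, HasDerivAt R (((R x) ^ 2 - 2 * M * R x + a ^ 2) / ((R x) ^ 2 + a ^ 2)) x) → (∀ x, Literature.Geometry.Lorentzian.Kerr.rPlus M a < R x) → Filter.Tendsto R Filter.atBot (nhds (Literature.Geometry.Lorentzian.Kerr.rPlus M a)) → Filter.Tendsto R Filter.atTop Filter.atTop → ∃ (α γ α₁ γ₁ : ℝ → ℝ) (β β₁ : ℝ → ℂ) (αp bp γp αm bm γm : ℝ), (∀ x, HasDerivAt α (α₁ x) x ∧ HasDerivAt γ (γ₁ x) x ∧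 HasDerivAt β (β₁ x) x) ∧ Continuous α₁ ∧ Continuous γ₁ ∧ Continuous β₁ ∧ (∀ x, |α x| ≤ 1 ∧ |γ x| ≤ 1 ∧ ‖β x‖ ≤ 1) ∧ Filter.Tendsto α Filter.atTop (nhds αp) ∧ Filter.Tendsto (fun x ↦ (β x).im) Filter.atTop (nhds bp) ∧ Filter.Tendsto γ Filter.atTop (nhds γp) ∧ Filter.Tendsto (fun x ↦ (β x).re) Filter.atTop (nhds 0) ∧ Filter.Tendsto α Filter.atBot (nhds αm) ∧ Filter.Tendsto (fun x ↦ (β x).im) Filter.atBot (nhds bm) ∧ Filter.Tendsto γ Filter.atBot (nhds γm) ∧ Filter.Tendsto (fun x ↦ (β x).re) Filter.atBot (nhds 0) ∧ γp + ω ^ 2 * αp + 2 * ω * bp ≤ 0 ∧ 0 ≤ γm + (ω - m * Literature.Geometry.Lorentzian.Kerr.horizonAngularVelocity M a) ^ 2 * αm - 2 * (ω - m * Literature.Geometry.Lorentzian.Kerr.horizonAngularVelocity M a) * bm ∧ ∀ (x r P h11 h22 : ℝ) (h12 : ℂ), r = R x → P = ω ^ 2 - ((4 * M * r * a * m * ω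 - a ^ 2 * (m : ℝ) ^ 2 + (r ^ 2 - 2 * M * r + a ^ 2) * Λ) / (r ^ 2 + a ^ 2) ^ 2 + (r ^ 2 - 2 * M * r + a ^ 2) * (3 * r ^ 2 - 4 * M * r + a ^ 2) / (r ^ 2 + a ^ 2) ^ 3 - 3 * (r ^ 2 - 2 * M * r + a ^ 2) ^ 2 * r ^ 2 / (r ^ 2 + a ^ 2) ^ 4) → h11 = α₁ x + 2 * (β x).re → h22 = γ₁ x - 2 * P * (β x).re → h12 = β₁ x + ((γ x - α x * P : ℝ) : ℂ) → (0 ≤ h11 ∧ 0 ≤ h22 ∧ ‖h12‖ ^ 2 ≤ h11 * h22) ∧ (Literature.Geometry.Lorentzian.Kerr.rPlus M a * (1 + δ) ≤ r → r ≤ Rc → η₀ ≤ h11 ∧ η₀ ≤ h22 ∧ ‖h12‖ ^ 2 ≤ (h11 - η₀) * (h22 - η₀))) → ∃ ρ : ℝ, 0 < ρ ∧ ∃ η : ℝ, 0 < η ∧ ∀ (a' ω' Λ' : ℝ), 0 ≤ a' → a' ≤ a₀ → |(m : ℝ)| * (|(m : ℝ)| + 1) ≤ Λ' → 2 * |a'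 * m * ω'| ≤ Λ' → |ω'| ≤ ωh → Λ' ≤ Λh → ε ≤ ω' → ω' + ε ≤ m * Literature.Geometry.Lorentzian.Kerr.horizonAngularVelocity M a' → |a' - a| < ρ → |ω' - ω| < ρ → |Λ' - Λ| < ρ → ∀ (R : ℝ → ℝ), (∀ x, HasDerivAt R (((R x) ^ 2 - 2 * M * R x + a' ^ 2) / ((R x) ^ 2 + a' ^ 2)) x) → (∀ x, Literature.Geometry.Lorentzian.Kerr.rPlus M a' < R x) → Filter.Tendsto R Filter.atBot (nhds (Literature.Geometry.Lorentzian.Kerr.rPlus M a')) → Filter.Tendsto R Filter.atTop Filter.atTop → ∃ (α γ α₁ γ₁ : ℝ → ℝ) (β β₁ : ℝ → ℂ) (αp bp γp αm bm γm : ℝ), (∀ x, HasDerivAt α (α₁ x) x ∧ HasDerivAt γ (γ₁ x) x ∧ HasDerivAt β (β₁ x) x) ∧ Continuous α₁ ∧ Continuous γ₁ ∧ Continuous β₁ ∧ (∀ x, |α x| ≤ 1 ∧ |γ x| ≤ 1 ∧ ‖β x‖ ≤ 1) ∧ Filter.Tendsto α Filter.atTop (nhds αp) ∧ Filter.Tendsto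 (fun x ↦ (β x).im) Filter.atTop (nhds bp) ∧ Filter.Tendsto γ Filter.atTop (nhds γp) ∧ Filter.Tendsto (fun x ↦ (β x).re) Filter.atTop (nhds 0) ∧ Filter.Tendsto α Filter.atBot (nhds αm) ∧ Filter.Tendsto (fun x ↦ (β x).im) Filter.atBot (nhds bm) ∧ Filter.Tendsto γ Filter.atBot (nhds γm) ∧ Filter.Tendsto (fun x ↦ (β x).re) Filter.atBot (nhds 0) ∧ γp + ω' ^ 2 * αp + 2 * ω' * bp ≤ 0 ∧ 0 ≤ γm + (ω' - m * Literature.Geometry.Lorentzian.Kerr.horizonAngularVelocity M a') ^ 2 * αm - 2 * (ω' - m * Literature.Geometry.Lorentzian.Kerr.horizonAngularVelocity M a') * bm ∧ ∀ (x r P h11 h22 : ℝ) (h12 : ℂ), r = R x → P = ω' ^ 2 - ((4 * M * r * a' * m * ω' - a' ^ 2 * (m : ℝ) ^ 2 + (r ^ 2 - 2 * M * r + a' ^ 2) * Λ') / (r ^ 2 + a' ^ 2) ^ 2 + (r ^ 2 - 2 * M * r + a' ^ 2) * (3 * r ^ 2 - 4 * M * r + a' ^ 2) / (r ^ 2 +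 a' ^ 2) ^ 3 - 3 * (r ^ 2 - 2 * M * r + a' ^ 2) ^ 2 * r ^ 2 / (r ^ 2 + a' ^ 2) ^ 4) → h11 = α₁ x + 2 * (β x).re → h22 = γ₁ x - 2 * P * (β x).re → h12 = β₁ x + ((γ x - α x * P : ℝ) : ℂ) → (0 ≤ h11 ∧ 0 ≤ h22 ∧ ‖h12‖ ^ 2 ≤ h11 * h22) ∧ (Literature.Geometry.Lorentzian.Kerr.rPlus M a' * (1 + δ) ≤ r → r ≤ Rc → η ≤ h11 ∧ η ≤ h22 ∧ ‖h12‖ ^ 2 ≤ (h11 - η) * (h22 - η)) := by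
  sorry

/-- **CE — COMPACT EXTRACTION OVER THE ADMISSIBLE BOX** (size M; topology + the Kerr bookkeeping that makes `K`
compact). For `0 < M`, `0 ≤ a₀ < M`, `ω_h`, `Λ_h`, `ε > 0` and ANY predicate `good a ω Λ m η`: if every point of
`K = {0 ≤ a ≤ a₀, Λ ≥ |m|(|m|+1), Λ ≥ 2|amω|, |ω| ≤ ω_h, Λ ≤ Λ_h, ε ≤ ω, ω + ε ≤ mω₊(M,a)}` has a box-neighbourhood
(radius `ρ > 0` in `(a, ω, Λ)`, same `m`) on which `good` holds with one `η > 0`, then there is ONE `η > 0` such that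
every point of `K` satisfies `good` with some `η' ≥ η`. Mechanism: only finitely many `m` occur
(`|m|(|m|+1) ≤ Λ_h`); for each `m` the slice `K_m ⊂ [0,a₀] × [ε, ω_h] × [0, Λ_h]` is closed because
`a ↦ ω₊(M,a) = a/(2M r₊(M,a))`, `r₊ = M + √(M² − a²)`, is continuous (`2M r₊ ≥ 2M² > 0`), hence compact; finite
subcover; `η :=` the minimum over the finitely many boxes. No monotonicity of `good` in `η` is assumed (the
conclusion hands back `η' ≥ η`; the composition weakens the margin itself).
Why it might fail: only by mis-typing — e.g. if `K_m` failed to be closed (it does not: all constraints are non-strict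
inequalities between continuous functions) or infinitely many `m` were admissible (they are not). A routine but
honest M-sized formalisation (Heine–Borel in `ℝ³`, `IsCompact.elim_finite_subcover`, finiteness in `m`).
Sources: Mathlib `IsCompact.elim_finite_subcover`, `Metric.isCompact_iff_isClosed_bounded`; arXiv:1402.7034 §8.1
(compactness-in-frequency architecture of the bounded regime). -/
theorem stub_compactExtraction : ∀ (M a₀ : ℝ), 0 < M → 0 ≤ a₀ → a₀ < M → ∀ (ωh Λh ε : ℝ), 0 < ε → ∀ (good : ℝ → ℝ → ℝ → ℤ → ℝ → Prop), (∀ (a ω Λ : ℝ) (m : ℤ), 0 ≤ a → a ≤ a₀ → |(m : ℝ)| * (|(m : ℝ)| + 1) ≤ Λ → 2 * |a * m * ω| ≤ Λ → |ω| ≤ ωh → Λ ≤ Λh → ε ≤ ω → ω + ε ≤ m * Literature.Geometry.Lorentzian.Kerr.horizonAngularVelocity M a → ∃ ρ : ℝ, 0 < ρ ∧ ∃ η : ℝ, 0 < η ∧ ∀ (a' ω' Λ' : ℝ), 0 ≤ a' → a' ≤ a₀ → |(m : ℝ)| * (|(m : ℝ)| + 1) ≤ Λ' → 2 * |a' * m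 * ω'| ≤ Λ' → |ω'| ≤ ωh → Λ' ≤ Λh → ε ≤ ω' → ω' + ε ≤ m * Literature.Geometry.Lorentzian.Kerr.horizonAngularVelocity M a' → |a' - a| < ρ → |ω' - ω| < ρ → |Λ' - Λ| < ρ → good a' ω' Λ' m η) → ∃ η : ℝ, 0 < η ∧ ∀ (a ω Λ : ℝ) (m : ℤ), 0 ≤ a → a ≤ a₀ → |(m : ℝ)| * (|(m : ℝ)| + 1) ≤ Λ → 2 * |a * m * ω| ≤ Λ → |ω| ≤ ωh → Λ ≤ Λh → ε ≤ ω → ω + ε ≤ m * Literature.Geometry.Lorentzian.Kerr.horizonAngularVelocity M a → ∃ η' : ℝ, η ≤ η' ∧ good a ω Λ m η' := by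
  sorry

/-! ## Composition: the crux BY NAME from the four stubs (real proof, no `sorry`) -/

/-- **CertificateFamily from RMS, LC, MR, CE.** Fix the data of the crux. Feed CE the predicate
`good a ω Λ m η' := ∀ R tortoise(M,a), certificate(M, a, R, ω, Λ, m; δ, R_c; η')`; its local-uniformity hypothesis
at a box point is MR applied to the pointwise family that LC produces from RMS (the point is strictly superradiant:
`0 < ε ≤ ω`, `ω + ε ≤ mω₊`). CE returns one `η > 0` and, at each admissible point, a certificate with some margin
`η' ≥ η`; the last five lines weaken the core clause from `η'` to `η`
(`(h₁₁ − η')(h₂₂ − η') ≤ (h₁₁ − η)(h₂₂ − η)` since `η ≤ η' ≤ h₁₁, h₂₂`). -/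
theorem CertificateFamily_of :
    Sig.stub_realModeStability → Sig.stub_lineCompleteness → Sig.stub_marginRobust →
      Sig.stub_compactExtraction →
        Summit.FinalStateConjecture.FinalStateConjecture.Theses.StorageCertificates.CertificateFamily := by
  intro hRMS hLC hROB hCE M a₀ hM ha₀ ha₀M ωh Λh ε δ Rc hε hδ
  obtain ⟨η, hη, hgood⟩ := hCE M a₀ hM ha₀ ha₀M ωh Λh ε hε
    (fun (a ω Λ : ℝ) (m : ℤ) (η' : ℝ) => ∀ (R : ℝ → ℝ), (∀ x, HasDerivAt R (((R x) ^ 2 - 2 * M * R x + a ^ 2) / ((R x) ^ 2 + a ^ 2)) x) → (∀ x, Literature.Geometry.Lorentzian.Kerr.rPlus M a < R x) → Filter.Tendsto R Filter.atBot (nhds (Literature.Geometry.Lorentzian.Kerr.rPlus M a)) → Filter.Tendsto R Filter.atTop Filter.atTop → ∃ (α γ α₁ γ₁ : ℝ → ℝ) (β β₁ : ℝ → ℂ) (αp bp γp αm bm γm : ℝ), (∀ x, HasDerivAt α (α₁ x) x ∧ HasDerivAt γ (γ₁ x) x ∧ HasDerivAt β (β₁ x) x) ∧ Continuous α₁ ∧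 Continuous γ₁ ∧ Continuous β₁ ∧ (∀ x, |α x| ≤ 1 ∧ |γ x| ≤ 1 ∧ ‖β x‖ ≤ 1) ∧ Filter.Tendsto α Filter.atTop (nhds αp) ∧ Filter.Tendsto (fun x ↦ (β x).im) Filter.atTop (nhds bp) ∧ Filter.Tendsto γ Filter.atTop (nhds γp) ∧ Filter.Tendsto (fun x ↦ (β x).re) Filter.atTop (nhds 0) ∧ Filter.Tendsto α Filter.atBot (nhds αm) ∧ Filter.Tendsto (fun x ↦ (β x).im) Filter.atBot (nhds bm) ∧ Filter.Tendsto γ Filter.atBot (nhds γm) ∧ Filter.Tendsto (fun x ↦ (β x).re) Filter.atBot (nhds 0) ∧ γp + ω ^ 2 * αp + 2 * ω * bp ≤ 0 ∧ 0 ≤ γm + (ω - m * Literature.Geometry.Lorentzian.Kerr.horizonAngularVelocity M a) ^ 2 * αm - 2 * (ω - m * Literature.Geometry.Lorentzian.Kerr.horizonAngularVelocity M a) * bm ∧ ∀ (x r P h11 h22 : ℝ) (h12 : ℂ), r = R x → P = ω ^ 2 - ((4 * M * r * a * m * ω - a ^ 2 * (m : ℝ) ^ 2 + (r ^ 2 -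 2 * M * r + a ^ 2) * Λ) / (r ^ 2 + a ^ 2) ^ 2 + (r ^ 2 - 2 * M * r + a ^ 2) * (3 * r ^ 2 - 4 * M * r + a ^ 2) / (r ^ 2 + a ^ 2) ^ 3 - 3 * (r ^ 2 - 2 * M * r + a ^ 2) ^ 2 * r ^ 2 / (r ^ 2 + a ^ 2) ^ 4) → h11 = α₁ x + 2 * (β x).re → h22 = γ₁ x - 2 * P * (β x).re → h12 = β₁ x + ((γ x - α x * P : ℝ) : ℂ) → (0 ≤ h11 ∧ 0 ≤ h22 ∧ ‖h12‖ ^ 2 ≤ h11 * h22) ∧ (Literature.Geometry.Lorentzian.Kerr.rPlus M a * (1 + δ) ≤ r → r ≤ Rc → η' ≤ h11 ∧ η' ≤ h22 ∧ ‖h12‖ ^ 2 ≤ (h11 - η') * (h22 - η')))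
    (fun a ω Λ m ha haa₀ h1 h2 h3 h4 h5 h6 =>
      hROB M a₀ hM ha₀ ha₀M ωh Λh ε δ Rc hε hδ a ω Λ m ha haa₀ h1 h2 h3 h4 h5 h6
        (hLC M a hM ha (lt_of_le_of_lt haa₀ ha₀M) δ Rc hδ ω Λ m h1 h2 (lt_of_lt_of_le hε h5) (by linarith)
          (fun R hR1 hR2 hR3 hR4 =>
            hRMS M a hM ha (lt_of_le_of_lt haa₀ ha₀M) R hR1 hR2 hR3 hR4 ω Λ m h1 h2
              (lt_of_lt_of_le hε h5) (by linarith))))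
  refine ⟨η, hη, ?_⟩
  intro a ha haa₀ R hR1 hR2 hR3 hR4 ω Λ m h1 h2 h3 h4 h5 h6
  obtain ⟨η', hηη', hcert⟩ := hgood a ω Λ m ha haa₀ h1 h2 h3 h4 h5 h6
  obtain ⟨α, γ, α₁, γ₁, β, β₁, αp, bp, γp, αm, bm, γm, hD, hcα, hcγ, hcβ, hbd, l1, l2, l3, l4, l5, l6, l7, l8,
    hend1, hend2, hH⟩ := hcert R hR1 hR2 hR3 hR4
  refine ⟨α, γ, α₁, γ₁, β, β₁, αp, bp, γp, αm, bm, γm, hD, hcα, hcγ, hcβ, hbd, l1, l2, l3, l4, l5, l6, l7, l8,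
    hend1, hend2, ?_⟩
  intro x r P h11 h22 h12 hr hP hh11 hh22 hh12
  obtain ⟨hpsd, hcore⟩ := hH x r P h11 h22 h12 hr hP hh11 hh22 hh12
  refine ⟨hpsd, fun hr1 hr2 => ?_⟩
  obtain ⟨e1, e2, e3⟩ := hcore hr1 hr2
  refine ⟨hηη'.trans e1, hηη'.trans e2, e3.trans ?_⟩
  exact mul_le_mul (by linarith) (by linarith) (by linarith) (by linarith)

/-- The crux by name, closed modulo the four registered stubs. -/
theorem certificateFamily_of_stubs :
    Summit.FinalStateConjecture.FinalStateConjecture.Theses.StorageCertificates.CertificateFamily :=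
  CertificateFamily_of stub_realModeStability stub_lineCompleteness stub_marginRobust stub_compactExtraction

end Summit.FinalStateConjecture.FinalStateConjecture.Cruxes.CertificateFamily.Birth
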